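import Summits.BirchSwinnertonDyer.BirchSwinnertonDyer.Theorems.Rank2ObservatoryKernelAnnihilator
import Summits.BirchSwinnertonDyer.BirchSwinnertonDyer.Theorems.Rank2ObservatoryCosetWitness
import HarnessLib

/-!
# BirchSwinnertonDyer — rank ≥ 2 observatory: the reduction witness, kernel-certified

HONEST FRAMING: per-curve certified theorems and census instruments; no claim on BSD in rank ≥ 2.

Third of three files discharging `hlow : 2 ≤ rank_ℤ E(ℚ)` by kernel certificate. Contents:

* the division-free DOUBLING TEST `xDoubleFree V q α` (Boolean: for all affine `(x₀, y₀)` on the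
  reduction with `D = 2y₀ + a₁x₀ + a₃ ≠ 0`, `α·D² ≠ n² + a₁nD − (a₂ + 2x₀)D²`) and its soundness
  `not_mem_twoCoset_of_xDoubleFree` : no point with `x`-coordinate `α` lies in `2Ẽ(𝔽_q)`;
* the integer CHORD CERTIFICATE `intChord` (`P₃ = P₁ + P₂`, denominators cleared) and its soundness
  `some_add_some_of_intChord`;
* **`two_le_mordellWeilRank_of_kernelCert`** — the assembly: three integral points
  `P₁, P₂, P₃ = P₁ + P₂` on `V`, an odd `t` with `annihilatorCheck S t = true` over kernel-counted
  good primes, and three good primes `qᵢ` at which `x(Pᵢ) mod qᵢ` is double-free give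
  `2 ≤ rank_ℤ E(ℚ)` through `two_le_mordellWeilRank_of_cosetWitness` (`u = 0`) and the Mordell–Weil
  theorem proved in the tree. EVERY hypothesis is a decidable statement about the integers /
  residues of the row, discharged per curve by `decide` (kernel; no `native_decide`; see
  `Rank2Observatory389a1RankTwo.lean`).

Scope (stated, not hidden): integral listed points with integral sum and an ODD torsion annihilator
(`u = 0`); rows with `Z ≠ 1` generators or even annihilator need the projective / `u ≥ 1` variant and
are not treated here. Sorry-free; axioms `propext`, `Classical.choice`, `Quot.sound` only.
References: Silverman AEC (2009) III.2.3, Prop. VII.3.1(b), Thm. VIII.6.7; Cremona (1997) §3.5.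
-/

-- single-conjunct summit: `Summit.BirchSwinnertonDyer.BirchSwinnertonDyer.…` repeats the name by design
set_option linter.dupNamespace false

namespace Summit.BirchSwinnertonDyer.BirchSwinnertonDyer.Rank2Observatory

open WeierstrassCurve Literature.NumberTheory.EllipticCurves

/-! ### The division-free doubling test: `α ∉ x(2Ẽ(𝔽_q))` -/

section Doubling

/-- Decidable DOUBLING TEST (a Boolean for `decide`): `α` is not the `x`-coordinate of `2 • (x₀, y₀)`
for any affine `(x₀, y₀)` on the reduction of `V` mod `q` with non-vertical tangent
(`D = 2y₀ + a₁x₀ + a₃ ≠ 0`), written without division: `α·D² ≠ n² + a₁·n·D − (a₂ + 2x₀)·D²`,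
`n = 3x₀² + 2a₂x₀ + a₄ − a₁y₀` (the duplication formula, Silverman AEC III.2.3).
[cite: SilvermanAEC2009, III.2.3] -/
def xDoubleFree (V : WeierstrassCurve ℤ) (q : ℕ) [NeZero q] (α : ZMod q) : Bool :=
  decide (∀ x₀ y₀ : ZMod q,
    y₀ ^ 2 + (V.a₁ : ZMod q) * x₀ * y₀ + (V.a₃ : ZMod q) * y₀ =
      x₀ ^ 3 + (V.a₂ : ZMod q) * x₀ ^ 2 + (V.a₄ : ZMod q) * x₀ + (V.a₆ : ZMod q) →
    2 * y₀ + (V.a₁ : ZMod q) * x₀ + (V.a₃ : ZMod q) ≠ 0 →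
    α * (2 * y₀ + (V.a₁ : ZMod q) * x₀ + (V.a₃ : ZMod q)) ^ 2 ≠
      (3 * x₀ ^ 2 + 2 * (V.a₂ : ZMod q) * x₀ + (V.a₄ : ZMod q) - (V.a₁ : ZMod q) * y₀) ^ 2
        + (V.a₁ : ZMod q) * (3 * x₀ ^ 2 + 2 * (V.a₂ : ZMod q) * x₀ + (V.a₄ : ZMod q)
            - (V.a₁ : ZMod q) * y₀) * (2 * y₀ + (V.a₁ : ZMod q) * x₀ + (V.a₃ : ZMod q))
        - ((V.a₂ : ZMod q) + 2 * x₀) * (2 * y₀ + (V.a₁ : ZMod q) * x₀ + (V.a₃ : ZMod q)) ^ 2)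

variable (V : WeierstrassCurve ℤ) (q : ℕ) [Fact q.Prime]

/-- **Soundness of the doubling test**: if `xDoubleFree V q α = true` then no point of `Ẽ(𝔽_q)`
with `x`-coordinate `α` lies in `2Ẽ(𝔽_q) = twoCoset _ 0`. (A point `2•b`: `b = O` or `2b = O` give
`O ≠ (α, β)`; otherwise `x(2b) = addX x₀ x₀ L` with `L·D = n`, and clearing `D²` is the tested
inequation.) [cite: SilvermanAEC2009, III.2.3] -/
theorem not_mem_twoCoset_of_xDoubleFree {α β : ZMod q} (hfree : xDoubleFree V q α = true)
    (h : (V.map (Int.castRingHom (ZMod q))).toAffine.Nonsingular α β) :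
    (Affine.Point.some α β h : (V.map (Int.castRingHom (ZMod q))).toAffine.Point) ∉
      twoCoset (V.map (Int.castRingHom (ZMod q))).toAffine.Point 0 := by
  simp only [xDoubleFree, decide_eq_true_eq] at hfree
  have ha₁ : (V.map (Int.castRingHom (ZMod q))).a₁ = (V.a₁ : ZMod q) := by
    simp [WeierstrassCurve.map]
  have ha₂ : (V.map (Int.castRingHom (ZMod q))).a₂ = (V.a₂ : ZMod q) := by
    simp [WeierstrassCurve.map]
  have ha₃ : (V.map (Int.castRingHom (ZMod q))).a₃ = (V.a₃ : ZMod q) := by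
    simp [WeierstrassCurve.map]
  have ha₄ : (V.map (Int.castRingHom (ZMod q))).a₄ = (V.a₄ : ZMod q) := by
    simp [WeierstrassCurve.map]
  have ha₆ : (V.map (Int.castRingHom (ZMod q))).a₆ = (V.a₆ : ZMod q) := by
    simp [WeierstrassCurve.map]
  rintro ⟨b, c, hc, hb⟩
  rw [pow_zero, one_smul] at hc
  subst hc
  rw [add_zero, two_zsmul] at hb
  rcases b with _ | ⟨x₀, y₀, h₀⟩
  · rw [← Affine.Point.zero_def, add_zero] at hb
    exact Affine.Point.some_ne_zero h hb
  · by_cases hy : y₀ = (V.map (Int.castRingHom (ZMod q))).toAffine.negY x₀ y₀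
    · rw [Affine.Point.add_self_of_Y_eq hy] at hb
      exact Affine.Point.some_ne_zero h hb
    · rw [Affine.Point.add_self_of_Y_ne hy, Affine.Point.some.injEq] at hb
      obtain ⟨hx, -⟩ := hb
      have hDval : y₀ - (V.map (Int.castRingHom (ZMod q))).toAffine.negY x₀ y₀ =
          2 * y₀ + (V.a₁ : ZMod q) * x₀ + (V.a₃ : ZMod q) := by
        simp only [Affine.negY, ha₁, ha₃]; ring
      have hD' : 2 * y₀ + (V.a₁ : ZMod q) * x₀ + (V.a₃ : ZMod q) ≠ 0 := by
        rw [← hDval]; exact sub_ne_zero.mpr hy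
      have heq : y₀ ^ 2 + (V.a₁ : ZMod q) * x₀ * y₀ + (V.a₃ : ZMod q) * y₀ =
          x₀ ^ 3 + (V.a₂ : ZMod q) * x₀ ^ 2 + (V.a₄ : ZMod q) * x₀ + (V.a₆ : ZMod q) := by
        have := (Affine.equation_iff x₀ y₀).mp h₀.1
        simpa only [ha₁, ha₂, ha₃, ha₄, ha₆] using this
      have hL : (V.map (Int.castRingHom (ZMod q))).toAffine.slope x₀ x₀ y₀ y₀ =
          (3 * x₀ ^ 2 + 2 * (V.a₂ : ZMod q) * x₀ + (V.a₄ : ZMod q) - (V.a₁ : ZMod q) * y₀) /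
            (2 * y₀ + (V.a₁ : ZMod q) * x₀ + (V.a₃ : ZMod q)) := by
        rw [Affine.slope_of_Y_ne rfl hy, hDval, ha₁, ha₂, ha₄]
      apply hfree x₀ y₀ heq hD'
      have hLD : (V.map (Int.castRingHom (ZMod q))).toAffine.slope x₀ x₀ y₀ y₀ *
          (2 * y₀ + (V.a₁ : ZMod q) * x₀ + (V.a₃ : ZMod q)) =
          3 * x₀ ^ 2 + 2 * (V.a₂ : ZMod q) * x₀ + (V.a₄ : ZMod q) - (V.a₁ : ZMod q) * y₀ := by
        rw [hL]; exact div_mul_cancel₀ _ hD'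
      rw [hx, ← hLD]
      simp only [Affine.addX, ha₁, ha₂]
      ring

end Doubling

/-! ### Integral points, the integer chord certificate, and the assembly -/

section Assembly

variable (V : WeierstrassCurve ℤ)

/-- `q ∤ Δ` for some `q` forces `Δ ≠ 0`. [folklore] -/
theorem Δ_ne_zero_of_not_dvd {q : ℕ} (hq : ¬ (q : ℤ) ∣ V.Δ) : V.Δ ≠ 0 :=
  fun h => hq (h ▸ dvd_zero _)

/-- The rational model of an integral model with `Δ ≠ 0` is an elliptic curve. [folklore] -/
theorem isElliptic_rat (hΔ : V.Δ ≠ 0) : (V.map (Int.castRingHom ℚ)).IsElliptic :=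
  ⟨by rw [map_Δ, eq_intCast]; exact isUnit_iff_ne_zero.mpr (by exact_mod_cast hΔ)⟩

/-- An integral solution of the Weierstrass equation is a nonsingular rational point (`Δ ≠ 0`).
[folklore] -/
theorem nonsingular_rat_of_eq (hΔ : V.Δ ≠ 0) {X Y : ℤ}
    (hXY : Y ^ 2 + V.a₁ * X * Y + V.a₃ * Y = X ^ 3 + V.a₂ * X ^ 2 + V.a₄ * X + V.a₆) :
    (V.map (Int.castRingHom ℚ)).toAffine.Nonsingular (X : ℚ) (Y : ℚ) := by
  have hΔ' : (V.map (Int.castRingHom ℚ)).Δ ≠ 0 := by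
    rw [map_Δ, eq_intCast]; exact_mod_cast hΔ
  exact (Affine.equation_iff_nonsingular_of_Δ_ne_zero hΔ').mp
    (equation_intCast_of_equation V ((Affine.equation_iff X Y).mpr hXY))

/-- Integer CHORD CERTIFICATE, denominators cleared (a Boolean for `decide`):
`(X₃, Y₃) = (X₁, Y₁) + (X₂, Y₂)` on `V` with `X₁ ≠ X₂`, `d = X₁ − X₂`, `m = Y₁ − Y₂`, slope `m/d`:
`X₃·d² = m² + a₁·m·d − (a₂ + X₁ + X₂)·d²` and `Y₃·d = −(m·(X₃ − X₁) + Y₁·d) − a₁·X₃·d − a₃·d`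
(the chord formula, Silverman AEC III.2.3). [cite: SilvermanAEC2009, III.2.3] -/
def intChord (V : WeierstrassCurve ℤ) (X₁ Y₁ X₂ Y₂ X₃ Y₃ : ℤ) : Bool :=
  decide (X₁ ≠ X₂ ∧
    X₃ * (X₁ - X₂) ^ 2 =
      (Y₁ - Y₂) ^ 2 + V.a₁ * (Y₁ - Y₂) * (X₁ - X₂) - (V.a₂ + X₁ + X₂) * (X₁ - X₂) ^ 2 ∧
    Y₃ * (X₁ - X₂) =
      -((Y₁ - Y₂) * (X₃ - X₁) + Y₁ * (X₁ - X₂)) - V.a₁ * X₃ * (X₁ - X₂) - V.a₃ * (X₁ - X₂))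

/-- **Soundness of the chord certificate**: the rational points add as certified
(Mathlib's `add_of_X_ne`, `slope_of_X_ne`, and clearing the denominator `X₁ − X₂ ≠ 0`).
[cite: SilvermanAEC2009, III.2.3] -/
theorem some_add_some_of_intChord (hΔ : V.Δ ≠ 0) {X₁ Y₁ X₂ Y₂ X₃ Y₃ : ℤ}
    (h₁ : Y₁ ^ 2 + V.a₁ * X₁ * Y₁ + V.a₃ * Y₁ = X₁ ^ 3 + V.a₂ * X₁ ^ 2 + V.a₄ * X₁ + V.a₆)
    (h₂ : Y₂ ^ 2 + V.a₁ * X₂ * Y₂ + V.a₃ * Y₂ = X₂ ^ 3 + V.a₂ * X₂ ^ 2 + V.a₄ * X₂ + V.a₆)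
    (h₃ : Y₃ ^ 2 + V.a₁ * X₃ * Y₃ + V.a₃ * Y₃ = X₃ ^ 3 + V.a₂ * X₃ ^ 2 + V.a₄ * X₃ + V.a₆)
    (hc : intChord V X₁ Y₁ X₂ Y₂ X₃ Y₃ = true) :
    (Affine.Point.some _ _ (nonsingular_rat_of_eq V hΔ h₁) :
        (V.map (Int.castRingHom ℚ)).toAffine.Point) + .some _ _ (nonsingular_rat_of_eq V hΔ h₂) =
      .some _ _ (nonsingular_rat_of_eq V hΔ h₃) := by
  classical
  simp only [intChord, decide_eq_true_eq] at hc
  obtain ⟨hne, hX, hY⟩ := hc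
  have hne' : ((X₁ : ℤ) : ℚ) ≠ X₂ := by exact_mod_cast hne
  have hd : ((X₁ : ℚ) - X₂) ≠ 0 := sub_ne_zero.mpr hne'
  have ha₁ : (V.map (Int.castRingHom ℚ)).a₁ = (V.a₁ : ℚ) := by simp [WeierstrassCurve.map]
  have ha₂ : (V.map (Int.castRingHom ℚ)).a₂ = (V.a₂ : ℚ) := by simp [WeierstrassCurve.map]
  have ha₃ : (V.map (Int.castRingHom ℚ)).a₃ = (V.a₃ : ℚ) := by simp [WeierstrassCurve.map]
  have hXq : (X₃ : ℚ) * ((X₁ : ℚ) - X₂) ^ 2 = ((Y₁ : ℚ) - Y₂) ^ 2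
      + (V.a₁ : ℚ) * ((Y₁ : ℚ) - Y₂) * ((X₁ : ℚ) - X₂)
      - ((V.a₂ : ℚ) + X₁ + X₂) * ((X₁ : ℚ) - X₂) ^ 2 := by exact_mod_cast hX
  have hYq : (Y₃ : ℚ) * ((X₁ : ℚ) - X₂) = -(((Y₁ : ℚ) - Y₂) * ((X₃ : ℚ) - X₁) + Y₁ * ((X₁ : ℚ) - X₂))
      - (V.a₁ : ℚ) * X₃ * ((X₁ : ℚ) - X₂) - (V.a₃ : ℚ) * ((X₁ : ℚ) - X₂) := by exact_mod_cast hY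
  rw [Affine.Point.add_of_X_ne hne', Affine.Point.some.injEq]
  set L := (V.map (Int.castRingHom ℚ)).toAffine.slope (X₁ : ℚ) X₂ Y₁ Y₂ with hLdef
  have hLd : L * ((X₁ : ℚ) - X₂) = (Y₁ : ℚ) - Y₂ := by
    rw [hLdef, Affine.slope_of_X_ne hne']; exact div_mul_cancel₀ _ hd
  have hX3 : (V.map (Int.castRingHom ℚ)).toAffine.addX (X₁ : ℚ) X₂ L = X₃ := by
    apply mul_right_cancel₀ (pow_ne_zero 2 hd)
    rw [hXq, ← hLd]
    simp only [Affine.addX, ha₁, ha₂]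
    ring
  refine ⟨hX3, ?_⟩
  simp only [Affine.addY, Affine.negAddY, Affine.negY, hX3, ha₁, ha₃]
  apply mul_right_cancel₀ hd
  rw [hYq, ← hLd]
  ring

/-- **The kernel certificate gives `rank_ℤ E(ℚ) ≥ 2`.** Inputs, every one a decidable statement
about the integers and residues of the row (discharged per curve by `decide`): the three integral
points `P₁ = (X₁,Y₁)`, `P₂ = (X₂,Y₂)`, `P₃ = (X₃,Y₃) = P₁ + P₂` (Weierstrass equations, chord
certificate); an odd `t` with `annihilatorCheck S t = true` for a list `S` of kernel-counted good
primes (`hS`, assembled by `killers_cons` / `killers_nil`); three good primes `qᵢ` at which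
`x(Pᵢ) mod qᵢ` is double-free. Output: `2 ≤ rank_ℤ E(ℚ)` for `E = V.map (ℤ → ℚ)`, by
`two_le_mordellWeilRank_of_cosetWitness` (`u = 0`, `m = t`) with the reduction homomorphisms
`reduceMod V qᵢ` and the Mordell–Weil theorem proved in the tree. This is the certificate field
`rank_lower` of the observatory made a kernel theorem. [cite: SilvermanAEC2009, Prop. VII.3.1(b) and Thm. VIII.6.7]
[cite: CremonaAlgorithms1997, §3.5] -/
theorem two_le_mordellWeilRank_of_kernelCert {X₁ Y₁ X₂ Y₂ X₃ Y₃ : ℤ}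
    (h₁ : Y₁ ^ 2 + V.a₁ * X₁ * Y₁ + V.a₃ * Y₁ = X₁ ^ 3 + V.a₂ * X₁ ^ 2 + V.a₄ * X₁ + V.a₆)
    (h₂ : Y₂ ^ 2 + V.a₁ * X₂ * Y₂ + V.a₃ * Y₂ = X₂ ^ 3 + V.a₂ * X₂ ^ 2 + V.a₄ * X₂ + V.a₆)
    (h₃ : Y₃ ^ 2 + V.a₁ * X₃ * Y₃ + V.a₃ * Y₃ = X₃ ^ 3 + V.a₂ * X₃ ^ 2 + V.a₄ * X₃ + V.a₆)
    (hc : intChord V X₁ Y₁ X₂ Y₂ X₃ Y₃ = true) {S : List (ℕ × ℕ)} {t : ℕ} (hodd : t % 2 = 1)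
    (hS : ∀ ℓN ∈ S, ℓN.1.Prime ∧
      ∀ (x : (V.map (Int.castRingHom ℚ)).toAffine.Point) (n : ℕ), ¬ ℓN.1 ∣ n → n • x = 0 →
        ℓN.2 • x = 0)
    (ht : annihilatorCheck S t = true) (q₁ q₂ q₃ : ℕ) [Fact q₁.Prime] [Fact q₂.Prime]
    [Fact q₃.Prime] (hq₁ : ¬ (q₁ : ℤ) ∣ V.Δ) (hq₂ : ¬ (q₂ : ℤ) ∣ V.Δ) (hq₃ : ¬ (q₃ : ℤ) ∣ V.Δ)
    (hw₁ : xDoubleFree V q₁ (X₁ : ZMod q₁) = true) (hw₂ : xDoubleFree V q₂ (X₂ : ZMod q₂) = true)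
    (hw₃ : xDoubleFree V q₃ (X₃ : ZMod q₃) = true) :
    2 ≤ (V.map (Int.castRingHom ℚ)).mordellWeilRank := by
  classical
  have hΔ : V.Δ ≠ 0 := Δ_ne_zero_of_not_dvd V hq₁
  haveI := isElliptic_rat V hΔ
  have hm : Odd (t : ℤ) := Int.odd_iff.mpr (by omega)
  have htors : ∀ x : (V.map (Int.castRingHom ℚ)).toAffine.Point, IsOfFinAddOrder x →
      ((2 : ℤ) ^ 0 * (t : ℤ)) • x = 0 :=
    fun x hx => zsmul_eq_zero_of_annihilatorCheck hS ht (by simp) x hx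
  have e₁ : V.toAffine.Equation X₁ Y₁ := (Affine.equation_iff X₁ Y₁).mpr h₁
  have e₂ : V.toAffine.Equation X₂ Y₂ := (Affine.equation_iff X₂ Y₂).mpr h₂
  have e₃ : V.toAffine.Equation X₃ Y₃ := (Affine.equation_iff X₃ Y₃).mpr h₃
  refine two_le_mordellWeilRank_of_cosetWitness (V.map (Int.castRingHom ℚ)) hm htors
    (P₁ := .some _ _ (nonsingular_rat_of_eq V hΔ h₁))
    (P₂ := .some _ _ (nonsingular_rat_of_eq V hΔ h₂))
    (reduceMod V q₁ hq₁) (reduceMod V q₂ hq₂) (reduceMod V q₃ hq₃) ?_ ?_ ?_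
  · rw [reduceMod_some V q₁ hq₁ e₁]
    exact not_mem_twoCoset_of_xDoubleFree V q₁ hw₁ _
  · rw [reduceMod_some V q₂ hq₂ e₂]
    exact not_mem_twoCoset_of_xDoubleFree V q₂ hw₂ _
  · rw [some_add_some_of_intChord V hΔ h₁ h₂ h₃ hc, reduceMod_some V q₃ hq₃ e₃]
    exact not_mem_twoCoset_of_xDoubleFree V q₃ hw₃ _

end Assembly

end Summit.BirchSwinnertonDyer.BirchSwinnertonDyer.Rank2Observatory
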